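import Literature.AlgebraicGeometry.Morphisms.SectionConormalHomComp   -- ★ p844469 (D2c-i) A-p01 (g22): `sectionConormalHom_comp`, `_congr`, `_id_self`, `sectionConormalHom_eq_sectionConormalEndo`
import HarnessLib

/-!
# Invariance of the section-conormal module and of the characteristic polynomial of `γ_v` under an ISOMORPHISM of pointed `R`-schemes
# (Görtz–Wedhorn II Remark 17.14 «functorial in the square»; (17.3))

Topic `Literature/AlgebraicGeometry/Morphisms`, namespace `Literature.AlgebraicGeometry.Morphisms`.  THEOREMS ONLY (no definition, no instance, no notation, no named fact,
no `sorry`); any commutative base ring `R`.  Sequel of ★ `Morphisms/SectionConormalHomComp` (D2c-i: the composition law `w(u) ∘ w(u') = w(u ≫ u')`).  Cell `pub/hodgecm-mathlib`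
(D-0151), programme P6 «MOD», ROW 3 organ L3.1∕L3.2, brick **(D2c-iii)** of A-p01 (g22) (13:15:20Z): for an ISOMORPHISM `u : X ≅ X'` of `R`-schemes carrying the section `e` of `X` to the
section `e'` of `X'`, the comparison `w(u) : I'∕I'² → I∕I²` of the conormal modules of the sections (any affine charts, any shrinking elements) is BIJECTIVE, intertwines
`γ_v` and `γ_{v'}` for `u`-conjugate endomorphisms (`v ≫ u = u ≫ v'`), transports `Module.Free`∕`Module.Finite`, and gives EQUAL characteristic polynomials.  This is the
lemma behind the base-change functoriality of the chart-local Kottwitz condition in the «local points» typing (a local point `x'` of `T'` IS the local point `x' ≫ g` of `T`,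
and `x'^*(g^*A) ≅ (x' ≫ g)^*A` — F0P6a-plan (g0) CENSUS-P6a §(vi), A-p01 13:15:20Z (β′)).  Kit author A-p07 (g17).
HONEST LABEL: HC_CM is proved only modulo the cell's 2 remaining named inputs (hLiu418 24832, h413 24833) until rung 0 closes; this file is unconditional (`--supports stmt-HodgeConjecture-24832`).

* `sectionConormalHom_comp_of_inverse` — `w(u) ∘ w(u⁻¹) = id`; `sectionConormalHom_bijective_of_inverse`;
* `sectionConormalEndo_comp_sectionConormalHom_of_conj` — `γ_v ∘ w(u) = w(u) ∘ γ_{v'}` when `v ≫ u = u ≫ v'`;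
* `free_∕finite_cotangent_sectionAug_of_iso`, **`charpoly_sectionConormalEndo_eq_of_iso`**.

## References
* [GortzWedhorn2023] U. Görtz, T. Wedhorn, *Algebraic Geometry II* (2023): Remark 17.14 (functoriality of `𝒞_i` in the square), (17.3).
* [EGAIV4] A. Grothendieck, J. Dieudonné, *EGA IV₄* (1967): (16.2.3), (16.4.1).
* [Kottwitz1992] R. E. Kottwitz, JAMS 5 (1992): §5 p. 390 (the determinant condition is a condition on the isomorphism class of `(A, i)`).
-/

set_option autoImplicit false

noncomputable section

-- `TopCat.Presheaf` is not reducible (as in ★ `Morphisms/SectionConormalChart`).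
set_option backward.isDefEq.respectTransparency false

open CategoryTheory AlgebraicGeometry TopologicalSpace Opposite
open Literature.RingTheory.Smooth

universe u

namespace Literature.AlgebraicGeometry.Morphisms

open ChartRing

section IsoInvariance

variable {R : Type u} [CommRing R] {X X' : Scheme.{u}} (f : X ⟶ Spec (.of R)) (f' : X' ⟶ Spec (.of R))
  (e : Spec (.of R) ⟶ X) (he : e ≫ f = 𝟙 _) (e' : Spec (.of R) ⟶ X') (he' : e' ≫ f' = 𝟙 _)
  {W : X.Opens} (heW : e ⁻¹ᵁ W = ⊤) {W' : X'.Opens} (heW' : e' ⁻¹ᵁ W' = ⊤) (hW : IsAffineOpen W) (hW' : IsAffineOpen W')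
  (u : X ⟶ X') (hu : u ≫ f' = f) (heu : e ≫ u = e') (u' : X' ⟶ X) (hu' : u' ≫ f = f') (heu' : e' ≫ u' = e)
  (huu' : u ≫ u' = 𝟙 X)
  (k : ChartRing f W) (hk : X.basicOpen (val k) ≤ u ⁻¹ᵁ W') (hhk : sectionAug f e he heW k = 1)
  (k' : ChartRing f' W') (hk' : X'.basicOpen (val k') ≤ u' ⁻¹ᵁ W) (hhk' : sectionAug f' e' he' heW' k' = 1)

include hu' heu' huu' hhk hhk' hW' in
/-- **`w(u) ∘ w(u⁻¹) = id`** on the conormal module `I∕I²` of the section of `X`, for an `R`-morphism `u : X → X'` with retraction `u'` (`u ≫ u' = 𝟙`) carrying section to section;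
any affine charts `W`, `W'` and shrinking elements. [cite: GortzWedhorn2023, Remark 17.14 and (17.3)] -/
theorem sectionConormalHom_comp_of_inverse :
    sectionConormalHom f f' e he e' he' heW heW' u hu heu k hk hW hhk ∘ₗ sectionConormalHom f' f e' he' e he heW' heW u' hu' heu' k' hk' hW' hhk' = LinearMap.id := by
  rw [sectionConormalHom_comp f f' f e he e' he' e he heW heW' heW hW hW' u hu heu u' hu' heu' k hk hhk k' hk' hhk' k
      (by rw [huu']; exact X.basicOpen_le (val k)) hhk,
    sectionConormalHom_congr f f e he e he heW heW hW huu' _ (Category.id_comp f) _ (Category.comp_id e) k _ (X.basicOpen_le (val k)) hhk,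
    sectionConormalHom_id_self f e he heW hW]

include hu' heu' huu' hhk hhk' hW' hk' in
/-- **`w(u)` IS BIJECTIVE for an isomorphism `u`** (`u ≫ u' = 𝟙`, `u' ≫ u = 𝟙`). [cite: GortzWedhorn2023, Remark 17.14 and (17.3)] -/
theorem sectionConormalHom_bijective_of_inverse (hu'u : u' ≫ u = 𝟙 X') :
    Function.Bijective (sectionConormalHom f f' e he e' he' heW heW' u hu heu k hk hW hhk) := by
  have h1 := sectionConormalHom_comp_of_inverse f f' e he e' he' heW heW' hW hW' u hu heu u' hu' heu' huu' k hk hhk k' hk' hhk'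
  have h2 := sectionConormalHom_comp_of_inverse f' f e' he' e he heW' heW hW' hW u' hu' heu' u hu heu hu'u k' hk' hhk' k hk hhk
  exact ⟨Function.LeftInverse.injective (g := sectionConormalHom f' f e' he' e he heW' heW u' hu' heu' k' hk' hW' hhk') fun x => LinearMap.congr_fun h2 x,
    Function.RightInverse.surjective (g := sectionConormalHom f' f e' he' e he heW' heW u' hu' heu' k' hk' hW' hhk') fun x => LinearMap.congr_fun h1 x⟩

include hhk in
/-- **`w(u)` INTERTWINES `u`-CONJUGATE ENDOMORPHISMS**: for `v` on `X`, `v'` on `X'` fixing the sections with `v ≫ u = u ≫ v'`, `γ_v ∘ w(u) = w(u) ∘ γ_{v'}` (any shrinking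
elements). [cite: GortzWedhorn2023, Remark 17.14] -/
theorem sectionConormalEndo_comp_sectionConormalHom_of_conj (v : X ⟶ X) (hv : v ≫ f = f) (hev : e ≫ v = e) (v' : X' ⟶ X') (hv' : v' ≫ f' = f') (hev' : e' ≫ v' = e')
    (hvv' : v ≫ u = u ≫ v')
    (h : ChartRing f W) (hhv : X.basicOpen (val h) ≤ v ⁻¹ᵁ W) (hh : sectionAug f e he heW h = 1)
    (h' : ChartRing f' W') (hh'v' : X'.basicOpen (val h') ≤ v' ⁻¹ᵁ W') (hh' : sectionAug f' e' he' heW' h' = 1) :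
    sectionConormalEndo f e he heW v hv hev h hhv hW hh ∘ₗ sectionConormalHom f f' e he e' he' heW heW' u hu heu k hk hW hhk =
      sectionConormalHom f f' e he e' he' heW heW' u hu heu k hk hW hhk ∘ₗ sectionConormalEndo f' e' he' heW' v' hv' hev' h' hh'v' hW' hh' := by
  -- one shrinking element for `v ≫ u = u ≫ v'` read from `W'` into `W`
  obtain ⟨h₀, hh₀, hh₀le⟩ := exists_sectionAug_eq_one_and_basicOpen_le f e he heW hW ((v ≫ u) ⁻¹ᵁ W') (by
    have h1 : (e ≫ v ≫ u) ⁻¹ᵁ W' = ⊤ := by rw [← Category.assoc, hev, heu]; exact heW'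
    exact h1)
  rw [← sectionConormalHom_eq_sectionConormalEndo, ← sectionConormalHom_eq_sectionConormalEndo,
    sectionConormalHom_comp f f f' e he e he e' he' heW heW heW' hW hW v hv hev u hu heu h hhv hh k hk hhk h₀ hh₀le hh₀,
    sectionConormalHom_comp f f' f' e he e' he' e' he' heW heW' heW' hW hW' u hu heu v' hv' hev' k hk hhk h' hh'v' hh' h₀
      (by rw [← hvv']; exact hh₀le) hh₀]
  exact sectionConormalHom_congr f f' e he e' he' heW heW' hW hvv' _ _ _ _ h₀ _ _ hh₀

include hW hu heu hk hu' heu' huu' hhk hhk' hW' hk' in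
/-- **`Module.Free` transports along an isomorphism of pointed `R`-schemes.** [cite: GortzWedhorn2023, (17.3)] -/
theorem free_cotangent_sectionAug_of_iso (hu'u : u' ≫ u = 𝟙 X') [Module.Free R (augIdeal (sectionAug f' e' he' heW')).Cotangent] :
    Module.Free R (augIdeal (sectionAug f e he heW)).Cotangent :=
  Module.Free.of_equiv (LinearEquiv.ofBijective _
    (sectionConormalHom_bijective_of_inverse f f' e he e' he' heW heW' hW hW' u hu heu u' hu' heu' huu' k hk hhk k' hk' hhk' hu'u))

include hW hu heu hk hu' heu' huu' hhk hhk' hW' hk' in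
/-- **`Module.Finite` transports along an isomorphism of pointed `R`-schemes.** [cite: GortzWedhorn2023, (17.3)] -/
theorem finite_cotangent_sectionAug_of_iso (hu'u : u' ≫ u = 𝟙 X') [Module.Finite R (augIdeal (sectionAug f' e' he' heW')).Cotangent] :
    Module.Finite R (augIdeal (sectionAug f e he heW)).Cotangent :=
  Module.Finite.equiv (LinearEquiv.ofBijective _
    (sectionConormalHom_bijective_of_inverse f f' e he e' he' heW heW' hW hW' u hu heu u' hu' heu' huu' k hk hhk k' hk' hhk' hu'u))

include hu heu hu' heu' huu' hhk hhk' hk hk' k k' in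
/-- **INVARIANCE OF THE CHARACTERISTIC POLYNOMIAL UNDER AN ISOMORPHISM OF POINTED `R`-SCHEMES**: for `u : X ≅ X'` (inverse `u'`) carrying the section of `X` to that of `X'`
and `u`-conjugate endomorphisms `v`, `v'` fixing the sections (`v ≫ u = u ≫ v'`), the characteristic polynomials of `γ_v` on `I∕I²` and of `γ_{v'}` on `I'∕I'²` AGREE (any affine
charts with free finite conormal modules, any shrinking elements). [cite: GortzWedhorn2023, Remark 17.14 and (17.3)] [cite: Kottwitz1992, §5 p. 390] -/
theorem charpoly_sectionConormalEndo_eq_of_iso (hu'u : u' ≫ u = 𝟙 X')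
    [Module.Free R (augIdeal (sectionAug f e he heW)).Cotangent] [Module.Finite R (augIdeal (sectionAug f e he heW)).Cotangent]
    [Module.Free R (augIdeal (sectionAug f' e' he' heW')).Cotangent] [Module.Finite R (augIdeal (sectionAug f' e' he' heW')).Cotangent]
    (v : X ⟶ X) (hv : v ≫ f = f) (hev : e ≫ v = e) (v' : X' ⟶ X') (hv' : v' ≫ f' = f') (hev' : e' ≫ v' = e') (hvv' : v ≫ u = u ≫ v')
    (h : ChartRing f W) (hhv : X.basicOpen (val h) ≤ v ⁻¹ᵁ W) (hh : sectionAug f e he heW h = 1)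
    (h' : ChartRing f' W') (hh'v' : X'.basicOpen (val h') ≤ v' ⁻¹ᵁ W') (hh' : sectionAug f' e' he' heW' h' = 1) :
    (sectionConormalEndo f e he heW v hv hev h hhv hW hh).charpoly = (sectionConormalEndo f' e' he' heW' v' hv' hev' h' hh'v' hW' hh').charpoly := by
  set c := LinearEquiv.ofBijective _
    (sectionConormalHom_bijective_of_inverse f f' e he e' he' heW heW' hW hW' u hu heu u' hu' heu' huu' k hk hhk k' hk' hhk' hu'u) with hc
  have hconj : sectionConormalEndo f e he heW v hv hev h hhv hW hh = c.conj (sectionConormalEndo f' e' he' heW' v' hv' hev' h' hh'v' hW' hh') := by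
    apply LinearMap.ext
    intro y
    obtain ⟨x, rfl⟩ := c.surjective y
    rw [LinearEquiv.conj_apply, LinearMap.comp_apply, LinearMap.comp_apply, LinearEquiv.coe_coe, LinearEquiv.coe_coe, LinearEquiv.symm_apply_apply]
    have := LinearMap.congr_fun (sectionConormalEndo_comp_sectionConormalHom_of_conj f f' e he e' he' heW heW' hW hW' u hu heu k hk hhk v hv hev v' hv' hev' hvv'
      h hhv hh h' hh'v' hh') x
    simpa only [LinearMap.comp_apply, hc, LinearEquiv.ofBijective_apply] using this
  rw [hconj, LinearEquiv.charpoly_conj]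

end IsoInvariance

end Literature.AlgebraicGeometry.Morphisms

end
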